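import Literature.Probability.RandomPlanarGeometry.RestrictionDensityLoewner
import HarnessLib

/-!
# A diagonal principle for the closed-half-plane convergence of [LSW] Lemma 3.5

G. F. Lawler, O. Schramm, W. Werner, *Conformal restriction: the chordal case*, J. Amer. Math.
Soc. **16** (2003) 917–955, arXiv:math/0209343 (**[LSW]**), proof of Lemma 3.5, p. 13: "It is
clear that `E_δ → A` as `δ → 0+` in the topology considered above. It thus suffices to
approximate `E_δ`." — approximants of approximants are approximants. The tree records this
diagonal extraction for the convergence `LSWConverges` (compacts of the OPEN set `ℍ ∖ A`;
`LSWConvergesDiagonal`) and, inside the proof of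
`IsPlusHull.exists_isLSWGenerated_lswConverges_of_arcHull` (`RestrictionDensityArc`), for hulls
DECREASING to `A`. Here is the version for the closed-half-plane convergence
`LSWClosedConverges` (compacts of `ℍ̄ ∖ A'`, `A' = A ∪ [x₀, x₁]`; `RestrictionDensityArc`) and
inner approximants:

* `IsPlusHull.exists_lswClosedConverges_diagonal` — let `A ∈ 𝒬₊` be nonempty, `J_n → A` in the
  sense `LSWClosedConverges` with `realFill (J_n) ⊆ realFill A` (e.g. sub-hulls `J_n ⊆ A` meeting
  `ℝ`), and for each `n` let `*`-hulls `B_{n,m} → J_n` (`m → ∞`) in the same sense. Then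
  `B_{n, m(n)} → A` for a suitable `m(n)`.

Proof: the compacts `T_ℓ = {im z ≥ 0, |z| ≤ ℓ+1, dist(z, A') ≥ 1/(ℓ+1)}` exhaust the compact
subsets of `ℍ̄ ∖ A'` and miss every `realFill (J_n)`; choose `m(n)` with `T_ℓ ∩ B_{n,m(n)} = ∅` and
`|χ_{n,m(n)} - Ψ_n| < 1/(n+1)` on `T_ℓ ∩ ℍ` for `ℓ ≤ n`, and with `B_{n,m(n)}` missing the shell
`{R + 1 ≤ |z| ≤ R_n} ∩ ℍ̄` (which forces `B_{n,m(n)} ⊆ B̄(0, R + 1)`); the common annulus then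
comes from `Loewner.exists_forall_subset_annulus`. Proof-only file; it is the last step of the
approximation of a smooth hull by `𝒜₀` through the slits of its boundary path
(`IsArcHull.exists_isLSWGenerated_lswClosedConverges`).
-/

noncomputable section

open Set Filter Metric Complex Bornology
open _root_.Topology
open UpperHalfPlane (upperHalfPlaneSet isOpen_upperHalfPlaneSet)

namespace Literature.Probability.RandomPlanarGeometry

/-! ### Test compacts exhausting `ℍ̄ ∖ A'` -/

section TestCompacts

/-- The test sets `T_ℓ(F) = {im z ≥ 0} ∩ B̄(0, ℓ+1) ∩ {dist(z, F) ≥ 1/(ℓ+1)}`. [folklore] -/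
def closedTestCompact (F : Set ℂ) (ℓ : ℕ) : Set ℂ :=
  {z : ℂ | 0 ≤ z.im} ∩ closedBall (0 : ℂ) ((ℓ : ℝ) + 1) ∩ {z : ℂ | 1 / ((ℓ : ℝ) + 1) ≤ infDist z F}

variable {F : Set ℂ}

/-- The test sets are compact. [folklore] -/
theorem isCompact_closedTestCompact (F : Set ℂ) (ℓ : ℕ) : IsCompact (closedTestCompact F ℓ) := by
  refine Metric.isCompact_of_isClosed_isBounded ?_ ?_
  · exact ((isClosed_le continuous_const Complex.continuous_im).inter isClosed_closedBall).inter
      (isClosed_le continuous_const (continuous_infDist_pt F))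
  · exact (isBounded_closedBall.subset inter_subset_right).subset inter_subset_left

/-- The test sets lie in the closed upper half-plane. [folklore] -/
theorem closedTestCompact_subset_closure (F : Set ℂ) (ℓ : ℕ) :
    closedTestCompact F ℓ ⊆ closure upperHalfPlaneSet := by
  rw [show upperHalfPlaneSet = {z : ℂ | 0 < z.im} from rfl, closure_setOf_lt_im]
  exact fun z hz ↦ hz.1.1

/-- The test sets miss `F` (and every subset of `F`). [folklore] -/
theorem disjoint_closedTestCompact {G : Set ℂ} (hG : G ⊆ F) (ℓ : ℕ) :
    Disjoint (closedTestCompact F ℓ) G := by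
  refine Set.disjoint_left.2 fun z hz hzG ↦ ?_
  have hpos : (0 : ℝ) < 1 / ((ℓ : ℝ) + 1) := by positivity
  have h0 : infDist z F = 0 := infDist_zero_of_mem (hG hzG)
  have := hz.2
  rw [mem_setOf_eq, h0] at this
  linarith

/-- **Exhaustion**: every compact subset of `ℍ̄` missing the closed nonempty `F` lies in some
test set `T_ℓ(F)`. [folklore] -/
theorem exists_subset_closedTestCompact (hFc : IsClosed F) (hFne : F.Nonempty) {S : Set ℂ}
    (hS : IsCompact S) (hSH : S ⊆ closure upperHalfPlaneSet) (hSF : Disjoint S F) :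
    ∃ ℓ : ℕ, S ⊆ closedTestCompact F ℓ := by
  rcases S.eq_empty_or_nonempty with rfl | hSne
  · exact ⟨0, empty_subset _⟩
  obtain ⟨z₂, hz₂, h₂⟩ := hS.exists_isMinOn hSne (continuous_infDist_pt F).continuousOn
  obtain ⟨R, hR⟩ := hS.isBounded.subset_closedBall 0
  have hd : 0 < infDist z₂ F :=
    (hFc.notMem_iff_infDist_pos hFne).1 (Set.disjoint_left.1 hSF hz₂)
  obtain ⟨ℓ, hℓ⟩ := exists_nat_gt (max (infDist z₂ F)⁻¹ R)
  have hℓ₁ : (infDist z₂ F)⁻¹ < (ℓ : ℝ) + 1 := by linarith [le_max_left (infDist z₂ F)⁻¹ R]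
  have hℓ₂ : R ≤ (ℓ : ℝ) + 1 := by linarith [le_max_right (infDist z₂ F)⁻¹ R]
  have him : S ⊆ {z : ℂ | 0 ≤ z.im} := by
    rw [show upperHalfPlaneSet = {z : ℂ | 0 < z.im} from rfl, closure_setOf_lt_im] at hSH
    exact hSH
  refine ⟨ℓ, fun z hz ↦ ⟨⟨him hz, closedBall_subset_closedBall hℓ₂ (hR hz)⟩, ?_⟩⟩
  have : 1 / ((ℓ : ℝ) + 1) < infDist z₂ F := by
    rw [one_div, inv_lt_comm₀ (by positivity) hd]; exact hℓ₁
  exact this.le.trans (h₂ hz)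

end TestCompacts

/-! ### The diagonal principle -/

/-- **Diagonal principle for `LSWClosedConverges`.** Let `A ∈ 𝒬₊` be nonempty with restriction
map `Φ`, let `J_n → A` (`LSWClosedConverges A Φ J Ψ`) with `realFill (J_n) ⊆ realFill A`, and
for every `n` let `*`-hulls `B_{n,m} → J_n` (`LSWClosedConverges (J n) (Ψ n) (B n) (χ n)`). Then
along a suitable `m(n)`, `B_{n,m(n)} → A`. ([LSW] p. 13, "It thus suffices to approximate `E_δ`":
the implicit diagonal extraction, for inner approximants and the closed-half-plane convergence.)
[cite: LawlerSchrammWerner2003Restriction, proof of Lemma 3.5 (p. 13)] -/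
theorem IsPlusHull.exists_lswClosedConverges_diagonal {A : Set ℂ} (hA : IsPlusHull A)
    (hne : A.Nonempty) {Φ : ConformalEquiv (upperHalfPlaneSet \ A) upperHalfPlaneSet}
    {J : ℕ → Set ℂ} {Ψ : ∀ n, ConformalEquiv (upperHalfPlaneSet \ J n) upperHalfPlaneSet}
    (hJfill : ∀ n, realFill (J n) ⊆ realFill A) (hconv : LSWClosedConverges A Φ J Ψ)
    {B : ℕ → ℕ → Set ℂ} {χ : ∀ n m, ConformalEquiv (upperHalfPlaneSet \ B n m) upperHalfPlaneSet}
    (hB : ∀ n m, IsStarHull (B n m)) (hBconv : ∀ n, LSWClosedConverges (J n) (Ψ n) (B n) (χ n)) :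
    ∃ m : ℕ → ℕ, LSWClosedConverges A Φ (fun n ↦ B n (m n)) (fun n ↦ χ n (m n)) := by
  -- constants attached to `A' = realFill A`
  set F : Set ℂ := realFill A with hF
  have hFc : IsCompact F := isCompact_realFill hA.1.isBoundedHull.isCompact
  have hFne : F.Nonempty := hne.mono (subset_realFill A)
  have hF0 : (0 : ℂ) ∉ F := hA.zero_notMem_realFill hne
  obtain ⟨ε, hε, hεF⟩ := Metric.isOpen_iff.1 hFc.isClosed.isOpen_compl 0 hF0
  obtain ⟨R, hR0, hR⟩ := hFc.isBounded.subset_closedBall_lt 0 0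
  set T : ℕ → Set ℂ := closedTestCompact F with hT
  have hTc : ∀ ℓ, IsCompact (T ℓ) := isCompact_closedTestCompact F
  have hTH : ∀ ℓ, T ℓ ⊆ closure upperHalfPlaneSet := closedTestCompact_subset_closure F
  have hTJ : ∀ ℓ n, Disjoint (T ℓ) (realFill (J n)) := fun ℓ n ↦ disjoint_closedTestCompact (hJfill n) ℓ
  have hTF : ∀ ℓ, Disjoint (T ℓ) F := fun ℓ ↦ disjoint_closedTestCompact subset_rfl ℓ
  -- the outer shells `S₂ n`
  choose δ' hδ'pos hδ' using fun n ↦ (hBconv n).exists_bound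
  set R₂ : ℕ → ℝ := fun n ↦ max (R + 1) (δ' n)⁻¹ with hR₂
  set S₂ : ℕ → Set ℂ := fun n ↦
    (closedBall (0 : ℂ) (R₂ n) \ ball 0 (R + 1)) ∩ closure upperHalfPlaneSet with hS₂
  have hS₂c : ∀ n, IsCompact (S₂ n) := fun n ↦
    ((isCompact_closedBall _ _).diff isOpen_ball).inter_right isClosed_closure
  have hS₂J : ∀ n, Disjoint (S₂ n) (realFill (J n)) := fun n ↦
    Set.disjoint_left.2 fun z hz hzF ↦ by
      have h1 : ‖z‖ ≤ R := by simpa using hR (hJfill n hzF)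
      have h2 : ¬ ‖z‖ < R + 1 := by simpa using hz.1.2
      exact h2 (by linarith)
  -- the choice of `m n`
  have hgood : ∀ n, ∃ m, Disjoint (S₂ n) (B n m) ∧
      ∀ ℓ ∈ Finset.range (n + 1), Disjoint (T ℓ) (B n m) ∧
        ∀ z ∈ T ℓ ∩ upperHalfPlaneSet, dist (Ψ n z) (χ n m z) < 1 / ((n : ℝ) + 1) := by
    intro n
    have hn1 : (0 : ℝ) < 1 / ((n : ℝ) + 1) := by positivity
    have e2 := (hBconv n).eventually_disjoint (hS₂c n) inter_subset_right (hS₂J n)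
    have e4 : ∀ᶠ m in atTop, ∀ ℓ ∈ Finset.range (n + 1), Disjoint (T ℓ) (B n m) ∧
        ∀ z ∈ T ℓ ∩ upperHalfPlaneSet, dist (Ψ n z) (χ n m z) < 1 / ((n : ℝ) + 1) := by
      refine (Filter.eventually_all_finset _).2 fun ℓ _ ↦ ?_
      filter_upwards [(hBconv n).eventually_disjoint (hTc ℓ) (hTH ℓ) (hTJ ℓ n),
        Metric.tendstoUniformlyOn_iff.1 ((hBconv n).tendstoUniformlyOn (hTc ℓ) (hTH ℓ) (hTJ ℓ n)) _ hn1]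
        with m hm hm' using ⟨hm, hm'⟩
    exact (e2.and e4).exists
  choose m hm₂ hm₄ using hgood
  refine ⟨m, ?_, ?_⟩
  · -- (i) the common annulus: eventually uniform, then uniform
    have hBH : ∀ n, B n (m n) ⊆ closure upperHalfPlaneSet := fun n ↦ (hB n (m n)).isBoundedHull.subset_closure
    -- the index `ℓ₀` from which `T ℓ₀` contains the closed half-disc of radius `ε/2`
    obtain ⟨ℓ₀, hℓ₀⟩ := exists_nat_gt (max (2 / ε) (ε / 2))
    have hℓ₀a : 1 / ((ℓ₀ : ℝ) + 1) ≤ ε / 2 := by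
      rw [div_le_iff₀ (by positivity)]
      have : 2 / ε < (ℓ₀ : ℝ) + 1 := by linarith [le_max_left (2 / ε) (ε / 2)]
      rw [div_lt_iff₀ hε] at this
      linarith
    have hℓ₀b : ε / 2 ≤ (ℓ₀ : ℝ) + 1 := by linarith [le_max_right (2 / ε) (ε / 2)]
    have hdiscT : closedBall (0 : ℂ) (ε / 2) ∩ closure upperHalfPlaneSet ⊆ T ℓ₀ := by
      rintro z ⟨hz, hzH⟩
      have hzH' : 0 ≤ z.im := by
        rw [show upperHalfPlaneSet = {z : ℂ | 0 < z.im} from rfl, closure_setOf_lt_im] at hzH; exact hzH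
      refine ⟨⟨hzH', closedBall_subset_closedBall hℓ₀b hz⟩, hℓ₀a.trans ?_⟩
      -- `dist(z, F) ≥ ε/2` since `B(0, ε) ∩ F = ∅` and `|z| ≤ ε/2`
      rw [le_infDist hFne]
      intro y hy
      by_contra hlt
      push Not at hlt
      have hy0 : y ∈ ball (0 : ℂ) ε := by
        rw [mem_ball, dist_zero_right]
        rw [mem_closedBall, dist_zero_right] at hz
        calc ‖y‖ = ‖z - (z - y)‖ := by rw [sub_sub_cancel]
          _ ≤ ‖z‖ + ‖z - y‖ := norm_sub_le _ _
          _ = ‖z‖ + dist z y := by rw [dist_eq_norm]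
          _ < ε / 2 + ε / 2 := add_lt_add_of_le_of_lt hz hlt
          _ = ε := by ring
      exact hεF hy0 hy
    have hev : ∀ᶠ n in atTop, B n (m n) ⊆
        {z : ℂ | min (ε / 2) (R + 1)⁻¹ ≤ ‖z‖ ∧ ‖z‖ ≤ (min (ε / 2) (R + 1)⁻¹)⁻¹} := by
      filter_upwards [eventually_ge_atTop ℓ₀] with n hn z hz
      refine ⟨(min_le_left _ _).trans (le_of_not_gt fun hlt ↦ ?_), ?_⟩
      · have hzT : z ∈ T ℓ₀ := hdiscT ⟨mem_closedBall_zero_iff.2 hlt.le, hBH n hz⟩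
        exact Set.disjoint_left.1 (hm₄ n ℓ₀ (Finset.mem_range_succ_iff.2 hn)).1 hzT hz
      · have hzR : ‖z‖ ≤ R + 1 := le_of_not_gt fun hlt ↦ by
          refine Set.disjoint_left.1 (hm₂ n) ⟨⟨?_, ?_⟩, hBH n hz⟩ hz
          · rw [mem_closedBall_zero_iff]
            exact ((hδ' n (m n) hz).2).trans (le_max_right _ _)
          · rw [mem_ball_zero_iff]; exact fun h ↦ absurd h (not_lt.2 hlt.le)
        have h := inv_anti₀ (lt_min (half_pos hε) (by positivity)) (min_le_right (ε / 2) (R + 1)⁻¹)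
        rw [inv_inv] at h
        exact hzR.trans h
    exact Loewner.exists_forall_subset_annulus (fun n ↦ hB n (m n))
      (lt_min (half_pos hε) (by positivity)) hev
  · -- (ii) compacts of `ℍ̄ ∖ A'`
    intro S hS hSH hSF
    obtain ⟨ℓ, hSℓ⟩ := exists_subset_closedTestCompact hFc.isClosed hFne hS hSH hSF
    refine ⟨?_, ?_⟩
    · filter_upwards [eventually_ge_atTop ℓ] with n hn
      exact (hm₄ n ℓ (Finset.mem_range_succ_iff.2 hn)).1.mono_left hSℓ
    · rw [Metric.tendstoUniformlyOn_iff]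
      intro e he
      have h1 := Metric.tendstoUniformlyOn_iff.1 (hconv.tendstoUniformlyOn (hTc ℓ) (hTH ℓ) (hTF ℓ))
        (e / 2) (half_pos he)
      have h2 : ∀ᶠ n : ℕ in atTop, 1 / ((n : ℝ) + 1) < e / 2 :=
        (tendsto_one_div_add_atTop_nhds_zero_nat).eventually (gt_mem_nhds (half_pos he))
      filter_upwards [h1, h2, eventually_ge_atTop ℓ] with n h1n h2n hn z hz
      have hzT : z ∈ T ℓ ∩ upperHalfPlaneSet := ⟨hSℓ hz.1, hz.2⟩
      have h3 := (hm₄ n ℓ (Finset.mem_range_succ_iff.2 hn)).2 z hzT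
      calc dist (Φ z) (χ n (m n) z) ≤ dist (Φ z) (Ψ n z) + dist (Ψ n z) (χ n (m n) z) :=
            dist_triangle _ _ _
        _ < e / 2 + e / 2 := add_lt_add (h1n z hzT) (h3.trans h2n)
        _ = e := by ring

end Literature.Probability.RandomPlanarGeometry
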